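import Summits.HodgeConjecture.HodgeConjecture.Theorems.PadicSemiregularLiftHodgeFermatVarietiesFibreOfBoundaryPow
import Summits.HodgeConjecture.HodgeConjecture.Theorems.PadicSemiregularLiftHodgeFermatVarietiesFibreOfBoundaryNat
import Summits.HodgeConjecture.HodgeConjecture.Theorems.PadicSemiregularLiftHodgeFermatVarietiesPairedOfLargePrimesSharp
import Literature.AlgebraicGeometry.HodgeTheory.FermatSurfaceHodgeCharacterStructureProofs
import HarnessLib

/-!
# The level analysis in length `≤ 6` at ANY level prime to `6` (twin small primes `5`, `7`) — line `cancel-by-any-claim-lattice`, crux `HodgeFermatVarieties` (stmt-HodgeConjecture-1334)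

Lead c4's programme T6 (Hodge characters of length `R ≤ 6` of `ℤ/m`, `(m, 6) = 1`, NO hypothesis on the primes), stub
T6-L2a `stub_fibre_of_top_level_le_six_of`, in ANTECEDENT form: the twin dichotomy T6-L1 (level `5^a 7^b n`, mass
`≤ 6`) and the level-`35` kill T6-K are the hypotheses `hBrick`, `hKill`. Setting: a Hodge character `α : Fin R → ℤ/m`,
`R ≤ 6`, a level `M ∣ m` whose unit-part multiplicity function `cnt_M` is not even while those of all proper multiples
of `M` are. THEOREM: for some `p₁ ∈ {5, 7}`: `p₁ ∣ M`, `M ≠ p₁`, and for a UNIT `x₀` mod `M` all but one of the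
points `x₀ + j(M/p₁)` (`j < p₁`) are unit parts of level-`M` entries of `α`.
Proof: Aoki's criterion at conductor `M` and the evenness above `M` make `T = cnt_M` orthogonal to the odd primitive
characters mod `M`; `T` is not even, so the refined counting `even_of_oddNull'` leaves a prime `p ∣ M` WITHOUT room,
`p ≤ #supp T + 1 ≤ 7`, i.e. `p ∈ {5, 7}`. (i)/(ii) Unless `#supp T = 6` and `35 ∣ M`, one prime `p ∈ {5, 7}` of `M`
has room at every OTHER prime of `M` (`7` has room when `#supp T ≤ 5`, primes `≥ 11` always); with `M = p^e n`,
`p ∤ n`, the dichotomies `stub_fibre_of_boundary_nat` (`e = 1`) / `even_or_fibre_of_boundary_pow_nat` (`e ≥ 2`) give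
the progression word for word as in `…FibreOfTopLevelPow`. (iii) If `#supp T = 6` and `35 ∣ M`, all `R = 6` entries
have level `M` and `T` has mass `6`: at `M = 35` the kill makes `cnt_M` even (excluded); otherwise `M = 5^a 7^b n ≠ 35`
and the twin dichotomy gives the progression directly.

References: [Aoki1983] N. Aoki, Math. Ann. 266 (1983) 23–54, Thm. A′ (§7), Prop. 2.2, Prop. 6.4.
-/

-- every sibling file of the line declares into `…CancelByAnyClaimLattice.PairedNull` from a differently named module
set_option linter.dupNamespace false

noncomputable section

open Finset
open Literature.AlgebraicGeometry.HodgeTheory Literature.AlgebraicGeometry.HodgeTheory.FermatCharacter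

namespace Summit.HodgeConjecture.HodgeConjecture.Theorems.CancelByAnyClaimLattice

namespace PairedNull

/-- A prime `≥ 5` other than `5` and `7` is at least `11`. [folklore] -/
private theorem eleven_le_of_prime_twin {p : ℕ} (hp : p.Prime) (h5 : 5 ≤ p) (hp5 : p ≠ 5) (hp7 : p ≠ 7) :
    11 ≤ p := by
  by_contra hlt
  interval_cases p <;> first | exact absurd rfl hp5 | exact absurd rfl hp7 | exact absurd hp (by decide)

section TopLevelTwin

variable {m : ℕ} [NeZero m] {R : ℕ} {α : Fin R → ZMod m}

/-- **The level analysis in length `≤ 6`, antecedent form** (section-variable form; see the module docstring): given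
the twin dichotomy `hBrick` and the level-`35` kill `hKill`, at a top non-even level `M` of a Hodge character of length
`R ≤ 6` (level prime to `6`) some `p₁ ∈ {5, 7}` divides `M`, `M ≠ p₁`, and `p₁ - 1` points `x₀ + j(M/p₁)` of a
progression through a UNIT `x₀` are unit parts of level-`M` entries. [cite: Aoki1983, Thm. A′ (§7), Prop. 2.2, Prop. 6.4] -/
theorem fibre_of_top_level_le_six_of
    (hBrick : ∀ (a b n : ℕ) [NeZero n], 1 ≤ a → 1 ≤ b → ¬ (a = 1 ∧ b = 1 ∧ n = 1) → (∀ p' ∈ n.primeFactors, 5 ≤ p') →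
      (5 ^ a * 7 ^ b).Coprime n → ∀ (T : ZMod (5 ^ a * (7 ^ b * n)) → ℂ), (∀ z, ∃ k : ℕ, T z = k) →
      (∀ z, ¬ IsUnit z → T z = 0) → (∀ χ : DirichletCharacter ℂ (5 ^ a * (7 ^ b * n)), χ.Odd → χ.IsPrimitive →
      ∑ z : ZMod (5 ^ a * (7 ^ b * n)), T z * χ z = 0) →
      (∀ p' ∈ n.primeFactors, #(univ.filter fun z : ZMod (5 ^ a * (7 ^ b * n)) ↦ T z ≠ 0) + 1 < p') →
      (∃ k : ℕ, k ≤ 6 ∧ ∑ z : ZMod (5 ^ a * (7 ^ b * n)), T z = k) → (∀ z, T (-z) = T z) ∨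
      ∃ p₁ : ℕ, (p₁ = 5 ∨ p₁ = 7) ∧ ∃ x₀ : ZMod (5 ^ a * (7 ^ b * n)), IsUnit x₀ ∧ ∃ j₀ : ℕ, j₀ < p₁ ∧
      ∀ j : ℕ, j < p₁ → j ≠ j₀ → T (x₀ + (j : ZMod (5 ^ a * (7 ^ b * n))) *
        ((5 ^ a * (7 ^ b * n) / p₁ : ℕ) : ZMod (5 ^ a * (7 ^ b * n)))) ≠ 0)
    (hKill : ∀ {m : ℕ} [NeZero m] {R : ℕ} {α : Fin R → ZMod m}, FermatCharacter.IsHodge α → (35 : ℕ) ∣ m →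
      (∀ i : Fin R, m / m.gcd (α i).val = 35) → ∀ u : ZMod 35,
      #(univ.filter fun i : Fin R ↦ ((((α i).val / (m / 35)) : ℕ) : ZMod 35) = -u) =
      #(univ.filter fun i : Fin R ↦ ((((α i).val / (m / 35)) : ℕ) : ZMod 35) = u))
    (hR : R ≤ 6) (hm6 : m.Coprime 6) (h : IsHodge α) {M : ℕ} (hMm : M ∣ m)
    (hne : ∃ v : ZMod M,
      #(univ.filter fun i : Fin R ↦ m / m.gcd (α i).val = M ∧ ((((α i).val / (m / M)) : ℕ) : ZMod M) = -v) ≠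
      #(univ.filter fun i : Fin R ↦ m / m.gcd (α i).val = M ∧ ((((α i).val / (m / M)) : ℕ) : ZMod M) = v))
    (hIH : ∀ M' : ℕ, M' ∣ m → M ∣ M' → M' ≠ M → ∀ u : ZMod M',
      #(univ.filter fun i : Fin R ↦ m / m.gcd (α i).val = M' ∧ ((((α i).val / (m / M')) : ℕ) : ZMod M') = -u) =
      #(univ.filter fun i : Fin R ↦ m / m.gcd (α i).val = M' ∧ ((((α i).val / (m / M')) : ℕ) : ZMod M') = u)) :
    ∃ p₁ : ℕ, (p₁ = 5 ∨ p₁ = 7) ∧ p₁ ∣ M ∧ M ≠ p₁ ∧ ∃ x₀ : ZMod M, IsUnit x₀ ∧ ∃ j₀ : ℕ, j₀ < p₁ ∧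
      ∀ j : ℕ, j < p₁ → j ≠ j₀ → ∃ i : Fin R, m / m.gcd (α i).val = M ∧
        ((((α i).val / (m / M)) : ℕ) : ZMod M) = x₀ + (j : ZMod M) * ((M / p₁ : ℕ) : ZMod M) := by
  classical
  have hm0 : m ≠ 0 := NeZero.ne m
  have hM0 : M ≠ 0 := fun h0 ↦ hm0 (by rw [h0] at hMm; exact zero_dvd_iff.mp hMm)
  haveI : NeZero M := ⟨hM0⟩
  -- the multiplicity function of the level-`M` unit parts
  set cnt : ZMod M → ℕ := fun u ↦
    #(univ.filter fun i : Fin R ↦ m / m.gcd (α i).val = M ∧ ((((α i).val / (m / M)) : ℕ) : ZMod M) = u) with hcnt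
  set T : ZMod M → ℂ := fun u ↦ (cnt u : ℂ) with hT
  have hTnat : ∀ u, ∃ k : ℕ, T u = k := fun u ↦ ⟨cnt u, rfl⟩
  have hnotev : ¬ ∀ u, T (-u) = T u := fun hev ↦ by
    obtain ⟨v, hv⟩ := hne
    exact hv (by simpa only [hT, Nat.cast_inj] using hev v)
  have hspec : ∀ i, IsUnit ((((α i).val / (m / (m / m.gcd (α i).val)) : ℕ) : ZMod (m / m.gcd (α i).val))) ∧
      ((m / (m / m.gcd (α i).val) : ℕ) : ZMod m) *
        ((ZMod.val ((((α i).val / (m / (m / m.gcd (α i).val)) : ℕ) : ZMod (m / m.gcd (α i).val))) : ℕ) : ZMod m)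
          = α i :=
    fun i ↦ unitPart_spec (α i)
  have hcastM : ∀ (L : ℕ) (_ : L = M) (y : ZMod m),
      (ZMod.cast ((((y.val / (m / L)) : ℕ) : ZMod L)) : ZMod M) = (((y.val / (m / M)) : ℕ) : ZMod M) := by
    intro L hL y; subst hL; exact ZMod.cast_id _ _
  have hcast : ∀ (L M' : ℕ) (_ : L = M') (hMM' : M ∣ M') (y : ZMod m),
      (ZMod.cast ((((y.val / (m / L)) : ℕ) : ZMod L)) : ZMod M) =
        ZMod.castHom hMM' (ZMod M) ((((y.val / (m / M')) : ℕ) : ZMod M')) := by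
    intro L M' hL hMM' y; subst hL; rfl
  have hTu : ∀ u, ¬ IsUnit u → T u = 0 := by
    intro u hu
    simp only [hT, Nat.cast_eq_zero, hcnt, Finset.card_eq_zero, Finset.filter_eq_empty_iff]
    intro i _ hi
    apply hu
    have hdvd : M ∣ m / m.gcd (α i).val := by rw [hi.1]
    rw [← hi.2, ← hcastM _ hi.1 (α i)]
    exact ((hspec i).1).map (ZMod.castHom hdvd (ZMod M))
  set I : Finset (Fin R) := univ.filter fun i : Fin R ↦ m / m.gcd (α i).val = M with hI
  have hsupp_img : (univ.filter fun u : ZMod M ↦ T u ≠ 0) =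
      I.image fun i ↦ ((((α i).val / (m / M)) : ℕ) : ZMod M) := by
    ext u
    rw [mem_filter, mem_image]
    simp only [mem_univ, true_and, hT, Nat.cast_ne_zero, hcnt]
    rw [Finset.card_ne_zero]
    constructor
    · rintro ⟨i, hi⟩
      rw [mem_filter] at hi
      exact ⟨i, by rw [hI, mem_filter]; exact ⟨mem_univ _, hi.2.1⟩, hi.2.2⟩
    · rintro ⟨i, hi, hiu⟩
      rw [hI, mem_filter] at hi
      exact ⟨i, by rw [mem_filter]; exact ⟨mem_univ _, hi.2, hiu⟩⟩
  have hIR : #I ≤ R := (card_le_univ I).trans (by rw [Fintype.card_fin])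
  have hsuppI : #(univ.filter fun u : ZMod M ↦ T u ≠ 0) ≤ #I := by rw [hsupp_img]; exact card_image_le
  -- the mass of `T` is `#I ≤ R ≤ 6`
  have hmass : ∑ u : ZMod M, T u = ((#I : ℕ) : ℂ) := by
    have h1 := sum_comp_eq_sum_card_mul I (fun i ↦ ((((α i).val / (m / M)) : ℕ) : ZMod M)) (fun _ ↦ (1 : ℂ))
    rw [Finset.sum_const, nsmul_eq_mul, mul_one] at h1
    rw [h1]
    refine Finset.sum_congr rfl fun u _ ↦ ?_
    rw [mul_one, hI, Finset.filter_filter]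
  -- every prime of `m` (hence of `M`) is at least `5`
  have hMm' : ∀ p ∈ M.primeFactors, p ∈ m.primeFactors := fun p hp ↦ Nat.mem_primeFactors.mpr
    ⟨Nat.prime_of_mem_primeFactors hp, (Nat.dvd_of_mem_primeFactors hp).trans hMm, hm0⟩
  have hM5 : ∀ p ∈ M.primeFactors, 5 ≤ p := by
    intro p hp
    have hpP := Nat.prime_of_mem_primeFactors hp
    have hpm := Nat.dvd_of_mem_primeFactors (hMm' p hp)
    have h2 : p ≠ 2 := by rintro rfl; exact absurd (Nat.Coprime.coprime_dvd_left hpm hm6) (by norm_num)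
    have h3 : p ≠ 3 := by rintro rfl; exact absurd (Nat.Coprime.coprime_dvd_left hpm hm6) (by norm_num)
    have h4 : p ≠ 4 := by rintro rfl; exact absurd hpP (by decide)
    have := hpP.two_le; omega
  haveI : ∀ i, NeZero (m / m.gcd (α i).val) := fun i ↦ ⟨(level_pos (α i)).ne'⟩
  -- Aoki's criterion at conductor `M`: `T` is orthogonal to the odd primitive characters mod `M`
  have hTodd : ∀ χ : DirichletCharacter ℂ M, χ.Odd → χ.IsPrimitive → ∑ u : ZMod M, T u * χ u = 0 := by
    intro χ hχ hprim
    have key := h.aoki_criterion hMm hχ hprim (fun i ↦ m / m.gcd (α i).val) (fun i ↦ level_dvd (α i))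
      (fun i ↦ ((((α i).val / (m / (m / m.gcd (α i).val)) : ℕ) : ZMod (m / m.gcd (α i).val))))
      (fun i ↦ (hspec i).1) (fun i ↦ (hspec i).2.symm)
    have hone : (∏ p ∈ M.primeFactors, (1 - χ p)) = 1 := by
      refine Finset.prod_eq_one fun p hp ↦ ?_
      have hnu : ¬ IsUnit ((p : ℕ) : ZMod M) := by
        rw [ZMod.isUnit_iff_coprime]
        exact fun hc ↦ (Nat.prime_of_mem_primeFactors hp).one_lt.ne' (hc.eq_one_of_dvd (Nat.dvd_of_mem_primeFactors hp))
      rw [χ.map_nonunit hnu, sub_zero]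
    have hA : (fun L : ℕ ↦ ((m.totient : ℂ) / (L.totient : ℂ)) * ∏ p ∈ L.primeFactors, (1 - χ p)) M ≠ 0 := by
      show ((m.totient : ℂ) / (M.totient : ℂ)) * ∏ p ∈ M.primeFactors, (1 - χ p) ≠ 0
      rw [hone, mul_one]
      exact div_ne_zero (by exact_mod_cast (Nat.totient_pos.mpr (NeZero.pos m)).ne')
        (by exact_mod_cast (Nat.totient_pos.mpr (NeZero.pos M)).ne')
    have key' := sum_level_eq_zero_of_criterion χ hχ (fun i ↦ m / m.gcd (α i).val)
      (fun i ↦ (level_pos (α i)).ne')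
      (fun i ↦ ((((α i).val / (m / (m / m.gcd (α i).val)) : ℕ) : ZMod (m / m.gcd (α i).val))))
      (fun L : ℕ ↦ ((m.totient : ℂ) / (L.totient : ℂ)) * ∏ p ∈ L.primeFactors, (1 - χ p)) hA key
      (fun i ↦ ((((α i).val / (m / M)) : ℕ) : ZMod M)) (fun i hi ↦ hcastM _ hi (α i))
      (fun L i ↦ ((((α i).val / (m / L)) : ℕ) : ZMod L)) (fun L hML i hiL ↦ hcast _ L hiL hML (α i))
      (fun L ⟨i, hiL⟩ hML hLM u ↦ hIH L (hiL ▸ level_dvd (α i)) hML hLM u)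
    rw [sum_comp_eq_sum_card_mul (univ.filter fun i : Fin R ↦ m / m.gcd (α i).val = M)
      (fun i ↦ ((((α i).val / (m / M)) : ℕ) : ZMod M)) (fun u ↦ (χ u)⁻¹)] at key'
    simp only [Finset.filter_filter] at key'
    have hconj : starRingEnd ℂ (∑ u : ZMod M, T u * χ u) = 0 := by
      rw [map_sum, ← key']
      refine Finset.sum_congr rfl fun u _ ↦ ?_
      rw [map_mul, hT, Complex.conj_natCast, char_inv_eq_conj]
    have := congrArg (starRingEnd ℂ) hconj
    rwa [starRingEnd_self_apply, map_zero] at this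
  -- the refined counting leaves a prime of `M` without room, necessarily `5` or `7`
  have hbad : ∃ p ∈ M.primeFactors, ¬ (#(univ.filter fun u : ZMod M ↦ T u ≠ 0) + 1 < p ∨
      (p = M.minFac ∧ p * p ∣ M ∧ #(univ.filter fun u : ZMod M ↦ T u ≠ 0) < p)) := by
    by_contra hgood
    push Not at hgood
    exact hnotev (even_of_oddNull' hM5 T hTu hTodd fun p hp ↦ by have := hgood p hp; tauto)
  obtain ⟨p₀, hp₀mem, hp₀bad⟩ := hbad
  have hp₀M : p₀ ∣ M := Nat.dvd_of_mem_primeFactors hp₀mem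
  have hp₀le : p₀ ≤ #(univ.filter fun u : ZMod M ↦ T u ≠ 0) + 1 := by by_contra hlt; exact hp₀bad (Or.inl (by omega))
  have hp₀57 : p₀ = 5 ∨ p₀ = 7 := by
    by_contra h57; push Not at h57
    have := eleven_le_of_prime_twin (Nat.prime_of_mem_primeFactors hp₀mem) (hM5 p₀ hp₀mem) h57.1 h57.2
    omega
  have hroom11 : ∀ p' ∈ M.primeFactors, p' ≠ 5 → p' ≠ 7 → #(univ.filter fun u : ZMod M ↦ T u ≠ 0) + 1 < p' := by
    intro p' hp' h5 h7
    have := eleven_le_of_prime_twin (Nat.prime_of_mem_primeFactors hp') (hM5 p' hp') h5 h7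
    omega
  -- the case split: the twin case (iii), or one prime `p ∈ {5, 7}` of `M` with room at every other prime of `M`
  have hsplit : (#(univ.filter fun u : ZMod M ↦ T u ≠ 0) = 6 ∧ 35 ∣ M) ∨ ∃ p, (p = 5 ∨ p = 7) ∧ p ∣ M ∧
      ∀ p' ∈ M.primeFactors, p' ≠ p → #(univ.filter fun u : ZMod M ↦ T u ≠ 0) + 1 < p' := by
    by_cases h7 : 7 ∣ M ∧ #(univ.filter fun u : ZMod M ↦ T u ≠ 0) = 6
    · by_cases h5 : 5 ∣ M
      · exact Or.inl ⟨h7.2, Nat.Coprime.mul_dvd_of_dvd_of_dvd (by norm_num) h5 h7.1⟩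
      · refine Or.inr ⟨7, Or.inr rfl, h7.1, fun p' hp' hne' ↦ hroom11 p' hp' ?_ hne'⟩
        rintro rfl; exact h5 (Nat.dvd_of_mem_primeFactors hp')
    · refine Or.inr ⟨5, Or.inl rfl, ?_, fun p' hp' hne' ↦ ?_⟩
      · rcases hp₀57 with rfl | rfl
        · exact hp₀M
        · exact absurd ⟨hp₀M, by omega⟩ h7
      · by_cases hp'7 : p' = 7
        · subst hp'7
          have : ¬ #(univ.filter fun u : ZMod M ↦ T u ≠ 0) = 6 := fun h6 ↦ h7 ⟨Nat.dvd_of_mem_primeFactors hp', h6⟩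
          omega
        · exact hroom11 p' hp' hne' hp'7
  rcases hsplit with ⟨hs6, h35⟩ | ⟨p, hp57, hpM, hroomM⟩
  · /- (iii) the twin case: all `R = 6` entries have level `M`, `T` has mass `6` -/
    have hIu : I = univ := Finset.eq_univ_of_card I (by rw [Fintype.card_fin]; omega)
    have hlev : ∀ i : Fin R, m / m.gcd (α i).val = M := fun i ↦ by
      have hi : i ∈ I := by rw [hIu]; exact mem_univ i
      rw [hI, mem_filter] at hi
      exact hi.2
    by_cases hM35 : M = 35
    · -- `M = 35`: the kill makes `cnt` even
      subst hM35
      refine absurd (fun u ↦ ?_) hnotev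
      have hf : ∀ w : ZMod 35, (univ.filter fun i : Fin R ↦ m / m.gcd (α i).val = 35 ∧
          ((((α i).val / (m / 35)) : ℕ) : ZMod 35) = w) =
          univ.filter fun i : Fin R ↦ ((((α i).val / (m / 35)) : ℕ) : ZMod 35) = w :=
        fun w ↦ Finset.filter_congr fun i _ ↦ and_iff_right (hlev i)
      simp only [hT, hcnt, hf, Nat.cast_inj]
      exact hKill h hMm hlev u
    · -- `M = 5^a 7^b n ≠ 35`: the twin dichotomy
      obtain ⟨a, n₁, h5n₁, hMeq⟩ := Nat.exists_eq_pow_mul_and_not_dvd hM0 5 (by norm_num)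
      have hn₁0 : n₁ ≠ 0 := fun h0 ↦ hM0 (by rw [hMeq, h0, mul_zero])
      obtain ⟨b, n, h7n, hn₁eq⟩ := Nat.exists_eq_pow_mul_and_not_dvd hn₁0 7 (by norm_num)
      subst hn₁eq
      subst hMeq
      have h5M : 5 ∣ 5 ^ a * (7 ^ b * n) := (Nat.dvd_mul_right 5 7).trans h35
      have h7M : 7 ∣ 5 ^ a * (7 ^ b * n) := (Nat.dvd_mul_left 7 5).trans h35
      have h5n : ¬ 5 ∣ n := fun h5 ↦ h5n₁ (h5.mul_left _)
      have ha : 1 ≤ a := by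
        by_contra ha0; rw [show a = 0 by omega, pow_zero, one_mul] at h5M; exact h5n₁ h5M
      have hb : 1 ≤ b := by
        by_contra hb0; rw [show b = 0 by omega, pow_zero, one_mul] at h7M
        exact h7n ((Nat.Coprime.pow_right a (by norm_num : Nat.Coprime 7 5)).dvd_of_dvd_mul_left h7M)
      have hn0 : n ≠ 0 := fun h0 ↦ hM0 (by rw [h0, mul_zero, mul_zero])
      haveI : NeZero n := ⟨hn0⟩
      have hnM : n ∣ 5 ^ a * (7 ^ b * n) := dvd_mul_of_dvd_right (dvd_mul_left n _) _
      have hn5 : ∀ p' ∈ n.primeFactors, 5 ≤ p' := fun p' hp' ↦ hM5 p' (Nat.mem_primeFactors.mpr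
        ⟨Nat.prime_of_mem_primeFactors hp', (Nat.dvd_of_mem_primeFactors hp').trans hnM, hM0⟩)
      have hc : (5 ^ a * 7 ^ b).Coprime n :=
        Nat.Coprime.mul_left (Nat.Coprime.pow_left a ((Nat.Prime.coprime_iff_not_dvd Nat.prime_five).mpr h5n))
          (Nat.Coprime.pow_left b ((Nat.Prime.coprime_iff_not_dvd Nat.prime_seven).mpr h7n))
      have h111 : ¬ (a = 1 ∧ b = 1 ∧ n = 1) := by
        rintro ⟨rfl, rfl, rfl⟩; exact hM35 (by norm_num)
      have hroom : ∀ p' ∈ n.primeFactors, #(univ.filter fun u : ZMod (5 ^ a * (7 ^ b * n)) ↦ T u ≠ 0) + 1 < p' := by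
        intro p' hp'
        have hp'n := Nat.dvd_of_mem_primeFactors hp'
        exact hroom11 p' (Nat.mem_primeFactors.mpr ⟨Nat.prime_of_mem_primeFactors hp', hp'n.trans hnM, hM0⟩)
          (fun h5 ↦ h5n (h5 ▸ hp'n)) (fun h7 ↦ h7n (h7 ▸ hp'n))
      rcases hBrick a b n ha hb h111 hn5 hc T hTnat hTu hTodd hroom ⟨#I, hIR.trans hR, hmass⟩ with
        hev | ⟨p₁, hp₁, x₀, hx₀, j₀, hj₀, hprog⟩
      · exact absurd hev hnotev
      have h35le : 35 ≤ 5 ^ a * (7 ^ b * n) := Nat.le_of_dvd (Nat.pos_of_ne_zero hM0) h35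
      refine ⟨p₁, hp₁, ?_, by omega, x₀, hx₀, j₀, hj₀, fun j hj hjne ↦ ?_⟩
      · rcases hp₁ with rfl | rfl
        · exact h5M
        · exact h7M
      have hne0 : cnt (x₀ + (j : ZMod (5 ^ a * (7 ^ b * n))) *
          ((5 ^ a * (7 ^ b * n) / p₁ : ℕ) : ZMod (5 ^ a * (7 ^ b * n)))) ≠ 0 := by
        have := hprog j hj hjne
        simpa only [hT, Nat.cast_ne_zero] using this
      obtain ⟨i, hi⟩ := Finset.card_ne_zero.mp hne0
      rw [mem_filter] at hi
      exact ⟨i, hi.2.1, hi.2.2⟩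
  /- (i)/(ii) one prime `p ∈ {5, 7}` of `M` without room, room at every other prime: `M = p^e n`, `p ∤ n` -/
  have hp : p.Prime := by rcases hp57 with rfl | rfl; exacts [Nat.prime_five, Nat.prime_seven]
  have hp5 : 5 ≤ p := by rcases hp57 with rfl | rfl <;> norm_num
  haveI : NeZero p := ⟨hp.ne_zero⟩
  obtain ⟨e, n, hpn, hMeq⟩ := Nat.exists_eq_pow_mul_and_not_dvd hM0 p hp.ne_one
  have he : 1 ≤ e := by
    by_contra he0; rw [show e = 0 by omega, pow_zero, one_mul] at hMeq; exact hpn (hMeq ▸ hpM)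
  have hn0 : n ≠ 0 := fun h0 ↦ hM0 (by rw [hMeq, h0, mul_zero])
  haveI : NeZero n := ⟨hn0⟩
  have hcpn : Nat.Coprime p n := (Nat.Prime.coprime_iff_not_dvd hp).mpr hpn
  have hnM : n ∣ M := ⟨p ^ e, by rw [hMeq, mul_comm]⟩
  have hn5 : ∀ p' ∈ n.primeFactors, 5 ≤ p' := fun p' hp' ↦ hM5 p' (Nat.mem_primeFactors.mpr
    ⟨Nat.prime_of_mem_primeFactors hp', (Nat.dvd_of_mem_primeFactors hp').trans hnM, hM0⟩)
  have hnroom : ∀ p' ∈ n.primeFactors, #(univ.filter fun u : ZMod M ↦ T u ≠ 0) + 1 < p' := by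
    intro p' hp'
    have hp'n := Nat.dvd_of_mem_primeFactors hp'
    exact hroomM p' (Nat.mem_primeFactors.mpr ⟨Nat.prime_of_mem_primeFactors hp', hp'n.trans hnM, hM0⟩)
      fun he' ↦ hpn (he' ▸ hp'n)
  have hMp : M ≠ p := by
    intro hEq; subst hEq; exact hnotev (even_of_oddNull_prime hp T hTu hTodd)
  refine ⟨p, hp57, hpM, hMp, ?_⟩
  rcases Nat.lt_or_ge e 2 with he1 | he2
  · /- `e = 1`: the level-`p n` dichotomy (all `p - 1` units of the fibre over `b`), base point `crt⁻¹(1, b)` -/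
    have he1' : e = 1 := by omega
    subst he1'
    rw [pow_one] at hMeq
    subst hMeq
    have hroom : ∀ p' ∈ n.primeFactors, #(univ.filter fun u : ZMod (p * n) ↦ T u ≠ 0) + 1 < p' := hnroom
    rcases stub_fibre_of_boundary_nat p n hp hp5 hpn hn5 hcpn T hTnat hTu hTodd hroom with hev | ⟨b, hbu, hfib⟩
    · exact absurd hev hnotev
    haveI : Fact p.Prime := ⟨hp⟩
    have hnp : (n : ZMod p) ≠ 0 := by rw [Ne, ZMod.natCast_eq_zero_iff]; exact hpn
    set c : ZMod p := -(n : ZMod p)⁻¹ with hcdef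
    refine ⟨(ZMod.chineseRemainder hcpn).symm (1, b), (isUnit_crt_symm_iff hcpn 1 b).mpr ⟨isUnit_one, hbu⟩,
      c.val, ZMod.val_lt c, fun j hj hjc ↦ ?_⟩
    have hy : (1 : ZMod p) + (j : ZMod p) * (n : ZMod p) ≠ 0 := by
      intro h0
      apply hjc
      have hj' : (j : ZMod p) = c := by
        rw [hcdef]
        have : (j : ZMod p) * (n : ZMod p) = -1 := by linear_combination h0
        calc (j : ZMod p) = (j : ZMod p) * (n : ZMod p) * (n : ZMod p)⁻¹ := by
              rw [mul_assoc, mul_inv_cancel₀ hnp, mul_one]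
          _ = -(n : ZMod p)⁻¹ := by rw [this]; ring
      have := congrArg ZMod.val hj'
      rwa [ZMod.val_natCast, Nat.mod_eq_of_lt hj] at this
    have hyu : IsUnit ((1 : ZMod p) + (j : ZMod p) * (n : ZMod p)) := isUnit_iff_ne_zero.mpr hy
    have hne0 : cnt ((ZMod.chineseRemainder hcpn).symm (((hyu.unit : (ZMod p)ˣ) : ZMod p), b)) ≠ 0 := by
      have := hfib hyu.unit
      simpa only [hT, Nat.cast_ne_zero] using this
    obtain ⟨i, hi⟩ := Finset.card_ne_zero.mp hne0
    rw [mem_filter] at hi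
    refine ⟨i, hi.2.1, ?_⟩
    rw [hi.2.2, IsUnit.unit_spec]
    -- `crt⁻¹(1 + j n, b) = crt⁻¹(1, b) + j · n`
    have hdiv : p * n / p = n := Nat.mul_div_cancel_left n hp.pos
    rw [hdiv]
    have h1 : ZMod.castHom (dvd_mul_right p n) (ZMod p) ((ZMod.chineseRemainder hcpn).symm (1, b) +
        (j : ZMod (p * n)) * (n : ZMod (p * n))) = 1 + (j : ZMod p) * (n : ZMod p) := by
      rw [map_add, map_mul, map_natCast, map_natCast, (castHom_crt_symm hcpn 1 b).1]
    have h2 : ZMod.castHom (dvd_mul_left n p) (ZMod n) ((ZMod.chineseRemainder hcpn).symm (1, b) +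
        (j : ZMod (p * n)) * (n : ZMod (p * n))) = b := by
      rw [map_add, map_mul, map_natCast, map_natCast, (castHom_crt_symm hcpn 1 b).2, ZMod.natCast_self, mul_zero, add_zero]
    have key := crt_symm_castHom hcpn ((ZMod.chineseRemainder hcpn).symm (1, b) + (j : ZMod (p * n)) * (n : ZMod (p * n)))
    rw [h1, h2] at key
    exact key
  · /- `e ≥ 2`: the prime-power dichotomy (a kernel coset of `p` units), base point `crt⁻¹(y₀, b)`, `j₀ = 0` -/
    subst hMeq
    haveI : NeZero (p ^ e) := ⟨pow_ne_zero e hp.ne_zero⟩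
    have hc : (p ^ e).Coprime n := Nat.Coprime.pow_left e hcpn
    have hd : p ^ (e - 1) ∣ p ^ e := pow_dvd_pow p (Nat.sub_le e 1)
    rcases even_or_fibre_of_boundary_pow_nat hp hp5 he rfl hn5 hc hd T hTnat hTu hTodd hnroom with
      hev | ⟨b, hbu, y₀, hfib⟩
    · exact absurd hev hnotev
    refine ⟨(ZMod.chineseRemainder hc).symm ((y₀ : ZMod (p ^ e)), b),
      (isUnit_crt_symm_iff hc _ b).mpr ⟨Units.isUnit y₀, hbu⟩, 0, hp.pos, fun j hj _ ↦ ?_⟩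
    set t : ZMod (p ^ e) := ((j * n : ℕ) : ZMod (p ^ e)) * ((y₀⁻¹ : (ZMod (p ^ e))ˣ) : ZMod (p ^ e)) with htdef
    have hwu : IsUnit ((1 : ZMod (p ^ e)) + ((p ^ (e - 1) : ℕ) : ZMod (p ^ e)) * (t.val : ZMod (p ^ e))) :=
      Literature.AlgebraicGeometry.HodgeTheory.AokiCoprimeSix.isUnit_one_add hp he (Or.inl he2)
    rw [ZMod.natCast_zmod_val] at hwu
    set w : (ZMod (p ^ e))ˣ := hwu.unit with hwdef
    have hwv : (w : ZMod (p ^ e)) = 1 + ((p ^ (e - 1) : ℕ) : ZMod (p ^ e)) * t := IsUnit.unit_spec _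
    have hwker : ZMod.unitsMap hd w = 1 := by
      apply Units.ext
      rw [coe_unitsMap, hwv, map_add, map_one, map_mul, map_natCast, ZMod.natCast_self, zero_mul, add_zero,
        Units.val_one]
    have hne0 : cnt ((ZMod.chineseRemainder hc).symm ((w : ZMod (p ^ e)) * y₀, b)) ≠ 0 := by
      have := hfib w hwker
      simpa only [hT, Nat.cast_ne_zero] using this
    obtain ⟨i, hi⟩ := Finset.card_ne_zero.mp hne0
    rw [mem_filter] at hi
    refine ⟨i, hi.2.1, ?_⟩
    rw [hi.2.2]
    -- `crt⁻¹(w y₀, b) = crt⁻¹(y₀, b) + j · (p^(e-1) n)`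
    have hdiv : p ^ e * n / p = p ^ (e - 1) * n := by
      have : p ^ e = p * p ^ (e - 1) := by rw [← pow_succ']; congr 1; omega
      rw [this, mul_assoc, Nat.mul_div_cancel_left _ hp.pos]
    rw [hdiv]
    have hwy : (w : ZMod (p ^ e)) * y₀ = y₀ + ((p ^ (e - 1) : ℕ) : ZMod (p ^ e)) * ((j * n : ℕ) : ZMod (p ^ e)) := by
      rw [hwv, htdef, add_mul, one_mul, mul_assoc, mul_assoc, Units.inv_mul, mul_one]
    have h1 : ZMod.castHom (dvd_mul_right (p ^ e) n) (ZMod (p ^ e))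
        ((ZMod.chineseRemainder hc).symm ((y₀ : ZMod (p ^ e)), b) +
          (j : ZMod (p ^ e * n)) * ((p ^ (e - 1) * n : ℕ) : ZMod (p ^ e * n))) = (w : ZMod (p ^ e)) * y₀ := by
      rw [map_add, map_mul, map_natCast, map_natCast, (castHom_crt_symm hc _ b).1, hwy]
      push_cast; ring
    have h2 : ZMod.castHom (dvd_mul_left n (p ^ e)) (ZMod n)
        ((ZMod.chineseRemainder hc).symm ((y₀ : ZMod (p ^ e)), b) +
          (j : ZMod (p ^ e * n)) * ((p ^ (e - 1) * n : ℕ) : ZMod (p ^ e * n))) = b := by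
      rw [map_add, map_mul, map_natCast, map_natCast, (castHom_crt_symm hc _ b).2, Nat.cast_mul, ZMod.natCast_self,
        mul_zero, mul_zero, add_zero]
    have key := crt_symm_castHom hc ((ZMod.chineseRemainder hc).symm ((y₀ : ZMod (p ^ e)), b) +
      (j : ZMod (p ^ e * n)) * ((p ^ (e - 1) * n : ℕ) : ZMod (p ^ e * n)))
    rw [h1, h2] at key
    exact key

end TopLevelTwin

/-- **T6-L2a `stub_fibre_of_top_level_le_six_of`** (registered form of `fibre_of_top_level_le_six_of`: the twin
dichotomy T6-L1 and the level-`35` kill T6-K are antecedents). [cite: Aoki1983, Thm. A′ (§7), Prop. 2.2, Prop. 6.4] -/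
theorem stub_fibre_of_top_level_le_six_of : (∀ (a b n : ℕ) [NeZero n], 1 ≤ a → 1 ≤ b → ¬ (a = 1 ∧ b = 1 ∧ n = 1) → (∀ p' ∈ n.primeFactors, 5 ≤ p') → (5 ^ a * 7 ^ b).Coprime n → ∀ (T : ZMod (5 ^ a * (7 ^ b * n)) → ℂ), (∀ z, ∃ k : ℕ, T z = k) → (∀ z, ¬ IsUnit z → T z = 0) → (∀ χ : DirichletCharacter ℂ (5 ^ a * (7 ^ b * n)), χ.Odd → χ.IsPrimitive → ∑ z : ZMod (5 ^ a * (7 ^ b * n)), T z * χ z = 0) → (∀ p' ∈ n.primeFactors, #(univ.filter fun z : ZMod (5 ^ a * (7 ^ b * n)) ↦ T z ≠ 0) + 1 < p') → (∃ k : ℕ, k ≤ 6 ∧ ∑ z : ZMod (5 ^ a * (7 ^ b * n)), T z = k) → (∀ z, T (-z) = T z) ∨ ∃ p₁ : ℕ, (p₁ = 5 ∨ p₁ = 7) ∧ ∃ x₀ : ZMod (5 ^ a * (7 ^ b * n)), IsUnit x₀ ∧ ∃ j₀ : ℕ, j₀ < p₁ ∧ ∀ j : ℕ, j < p₁ → j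 ≠ j₀ → T (x₀ + (j : ZMod (5 ^ a * (7 ^ b * n))) * ((5 ^ a * (7 ^ b * n) / p₁ : ℕ) : ZMod (5 ^ a * (7 ^ b * n)))) ≠ 0) → (∀ {m : ℕ} [NeZero m] {R : ℕ} {α : Fin R → ZMod m}, FermatCharacter.IsHodge α → (35 : ℕ) ∣ m → (∀ i : Fin R, m / m.gcd (α i).val = 35) → ∀ u : ZMod 35, #(univ.filter fun i : Fin R ↦ ((((α i).val / (m / 35)) : ℕ) : ZMod 35) = -u) = #(univ.filter fun i : Fin R ↦ ((((α i).val / (m / 35)) : ℕ) : ZMod 35) = u)) → ∀ (R : ℕ), R ≤ 6 → ∀ {m : ℕ} [NeZero m] {α : Fin R → ZMod m}, m.Coprime 6 → FermatCharacter.IsHodge α → ∀ {M : ℕ}, M ∣ m → (∃ v : ZMod M, #(univ.filter fun i : Fin R ↦ m / m.gcd (α i).val = M ∧ ((((α i).val / (m / M)) : ℕ) : ZMod M) = -v) ≠ #(univ.filter fun i : Fin R ↦ m / m.gcd (α i).val = M ∧ ((((α i).val / (m / M)) : ℕ) : ZMod M) = v)) → (∀ M' : ℕ, M' ∣ m → M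 ∣ M' → M' ≠ M → ∀ u : ZMod M', #(univ.filter fun i : Fin R ↦ m / m.gcd (α i).val = M' ∧ ((((α i).val / (m / M')) : ℕ) : ZMod M') = -u) = #(univ.filter fun i : Fin R ↦ m / m.gcd (α i).val = M' ∧ ((((α i).val / (m / M')) : ℕ) : ZMod M') = u)) → ∃ p₁ : ℕ, (p₁ = 5 ∨ p₁ = 7) ∧ p₁ ∣ M ∧ M ≠ p₁ ∧ ∃ x₀ : ZMod M, IsUnit x₀ ∧ ∃ j₀ : ℕ, j₀ < p₁ ∧ ∀ j : ℕ, j < p₁ → j ≠ j₀ → ∃ i : Fin R, m / m.gcd (α i).val = M ∧ ((((α i).val / (m / M)) : ℕ) : ZMod M) = x₀ + (j : ZMod M) * ((M / p₁ : ℕ) : ZMod M) :=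
  fun hBrick hKill _ hR _ _ _ hm6 h _ hMm hne hIH ↦ fibre_of_top_level_le_six_of hBrick @hKill hR hm6 h hMm hne hIH

end PairedNull

end Summit.HodgeConjecture.HodgeConjecture.Theorems.CancelByAnyClaimLattice

end
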